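import Summits.BirchSwinnertonDyer.BirchSwinnertonDyer.Theorems.ShaPrimaryTransferFiniteShaComponentTransferEisensteinTwistDoor
import Literature.NumberTheory.EllipticCurves.KubertTate277EisensteinTwist
import HarnessLib

/-!
# BirchSwinnertonDyer / ShaPrimaryTransfer — crux `FiniteShaComponentTransfer` (stmt-BirchSwinnertonDyer-22356):
# the second RANK-1 Eisenstein-twist door `W₂ = [0, 261, −11, 118014, −12051831] ≅ E_{27/7}^{(-3)}`, through the CLASS-WIDE reading

Helper file of prover seat `bsd-line-spt-p1` g22 (`--supports stmt-22356 --as helper`). THEOREMS ONLY.  One-line instantiation of the class-wide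
`ShaPrimaryTransferEisensteinTwistDoor.transfer_of_eisensteinTwistModel_of_thmE` at `(m, n) = (27, 7)`: `E_{27/7} = [-20, -189, -1323, 0, 0]`
(rank `1`, full box, Eisenstein-tame, `ω₂(189) = 1`), twist minimal model `W₂` (tree `KubertTate277EisensteinTwist`: rank `1` by one point with
`3 ∣ den x`, `t₅ = 0`, `a₅ = -1`, `corank_{ℤ₅} Sel_{5^∞} = 1`).

* `oneFiniteShaComponent_W₂` (unconditional, door `5`), `transfer_W₂` (T by name);
* `analyticRank_W₂_eq_one_and_finite_sha_of_thmE`, **`transfer_W₂_of_thmE`** — modulo CGLS Thm. E + GZK: `ord_{s=1} L(W₂, s) = 1`, `Ш(W₂/ℚ)`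
  finite, and T HOLDS AT `W₂`.

T itself is UNCHANGED (open at corank ≥ 2) and BSD is NOT proved by any of this.

## References

* [CastellaGrossiLeeSkinner2022] F. Castella, G. Grossi, J. Lee, C. Skinner, Invent. Math. 227 (2022), Theorem E.
* [Darmon2004] H. Darmon, CBMS 101, Thm. 3.22 (Gross–Zagier–Kolyvagin).
* [SilvermanAEC2009] J. H. Silverman, *AEC*, 2nd ed., Thm. X.4.2, Exercise 10.16.
-/

-- D-0017: single-problem summit, so `Summit.BirchSwinnertonDyer.BirchSwinnertonDyer.…` repeats a namespace BY DESIGN.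
set_option linter.dupNamespace false
set_option autoImplicit false

noncomputable section

open scoped Classical
open Literature.NumberTheory.EllipticCurves WeierstrassCurve
open Literature.NumberTheory.EllipticCurves.Rank1Residual
open Literature.NumberTheory.EllipticCurves.CastellaGrossiLeeSkinner2022
open Summit.BirchSwinnertonDyer.BirchSwinnertonDyer.Theses.ShaPrimaryTransfer
open Summit.BirchSwinnertonDyer.BirchSwinnertonDyer.Theorems.ShaPrimaryTransferEisensteinTwistDoor

namespace Summit.BirchSwinnertonDyer.BirchSwinnertonDyer.Theorems.ShaPrimaryTransferEisensteinTwistDoor277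

/-- The reference point `(35, 98)` of `E_{27/7}`. [folklore] -/
private theorem nonsingular_ref :
    (kubertTateFive (((27 : ℤ) : ℚ)) (((7 : ℤ) : ℚ))).toAffine.Nonsingular 35 98 :=
  haveI := KubertTate277Descent.isElliptic
  (KubertTate277Descent.nonsingular_iff _ _).mpr (by norm_num)

/-- `ω(189) = 2`, `ω₂(189) = 1`. [folklore] -/
private theorem card_primeFactors :
    (((27 : ℤ) * 7).natAbs.primeFactors).card = 2 ∧ ((((27 : ℤ) * 7).natAbs.primeFactors.filter (fun ℓ ↦ ℓ % 3 = 1))).card = 1 := by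
  have e : ((27 : ℤ) * 7).natAbs = 3 ^ 3 * 7 := by norm_num
  rw [e, Nat.primeFactors_mul (by norm_num) (by norm_num), Nat.primeFactors_prime_pow (by norm_num) Nat.prime_three,
    Nat.Prime.primeFactors (by norm_num : Nat.Prime 7)]
  exact ⟨by decide, by decide⟩

/-- **O for `W₂` with witness `p₀ = 5`, unconditional** (class-wide `oneFiniteShaComponent_of_eisensteinTwistModel`). [cite: SilvermanAEC2009, Thm. X.4.2] -/
theorem oneFiniteShaComponent_W₂ :
    haveI := KubertTate277EisensteinTwist.isElliptic_model
    ∃ (p : ℕ) (_ : Fact p.Prime),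
      (⟨((0 : ℤ) : ℚ), ((261 : ℤ) : ℚ), ((-11 : ℤ) : ℚ), ((118014 : ℤ) : ℚ), ((-12051831 : ℤ) : ℚ)⟩ : WeierstrassCurve ℚ).shaCorank p = 0 := by
  haveI := KubertTate277Descent.isElliptic
  haveI := KubertTate277EisensteinTwist.isElliptic_twist
  haveI := KubertTate277EisensteinTwist.isElliptic_model
  haveI := KubertTate277EisensteinTwist.isGloballyMinimal_model
  haveI : Fact (Nat.Prime 11) := ⟨by norm_num⟩
  obtain ⟨hω, hω₂⟩ := card_primeFactors
  have hr : ((27 : ℤ) * 7).natAbs.primeFactors.card ≤ (kubertTateFive (((27 : ℤ) : ℚ)) (((7 : ℤ) : ℚ))).mordellWeilRank + 1 := by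
    rw [hω, KubertTate277Descent.mordellWeilRank_eq]
  have hr' : (((27 : ℤ) * 7).natAbs.primeFactors.filter (fun ℓ ↦ ℓ % 3 = 1)).card ≤
      ((kubertTateFive (((27 : ℤ) : ℚ)) (((7 : ℤ) : ℚ))).quadraticTwist (-3)).mordellWeilRank := by
    rw [hω₂, KubertTate277EisensteinTwist.twist_27_7.1]
  exact oneFiniteShaComponent_of_eisensteinTwistModel 27 7 KubertTate277Descent.not_five_dvd_Δ KubertTate277EisensteinTwist.eisenstein_tame
    nonsingular_ref (by norm_num) (by norm_num) 11 (by norm_num) (by norm_num) KubertTate277Descent.not_tor_dvd_Δ hr hr' _ _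
    KubertTate277EisensteinTwist.variableChange_model

/-- **T BY NAME on `W₂`**: granting `FiniteShaComponentTransfer`, every `t_q(W₂) = 0`. T itself is NOT proved. [cite: SilvermanAEC2009, Thm. X.4.2] -/
theorem transfer_W₂ (hT : FiniteShaComponentTransfer) (q : ℕ) [Fact q.Prime] :
    haveI := KubertTate277EisensteinTwist.isElliptic_model
    (⟨((0 : ℤ) : ℚ), ((261 : ℤ) : ℚ), ((-11 : ℤ) : ℚ), ((118014 : ℤ) : ℚ), ((-12051831 : ℤ) : ℚ)⟩ : WeierstrassCurve ℚ).shaCorank q = 0 := by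
  haveI := KubertTate277EisensteinTwist.isElliptic_model
  obtain ⟨p, hp, h0⟩ := oneFiniteShaComponent_W₂
  exact hT _ p q h0

/-- **`ord_{s=1} L(W₂, s) = 1 = rank W₂(ℚ)` and `Ш(W₂/ℚ)` finite, modulo CGLS Thm. E + GZK** (class-wide
`analyticRank_eq_and_finite_sha_of_eisensteinTwistModel_of_thmE` at `(27, 7)`, `ω₂ = 1`). [cite: CastellaGrossiLeeSkinner2022, Theorem E (r = 1)]
[cite: Darmon2004, Thm. 3.22] -/
theorem analyticRank_W₂_eq_one_and_finite_sha_of_thmE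
    (h1 : thmE_analyticRank_eq_one_of_selmerCorank_eq_one) (h0 : thmE_analyticRank_eq_zero_of_selmerCorank_eq_zero)
    (hGZK : rank_eq_analyticRank_of_analyticRank_le_one) :
    haveI := KubertTate277EisensteinTwist.isElliptic_model
    (⟨((0 : ℤ) : ℚ), ((261 : ℤ) : ℚ), ((-11 : ℤ) : ℚ), ((118014 : ℤ) : ℚ), ((-12051831 : ℤ) : ℚ)⟩ : WeierstrassCurve ℚ).analyticRank = 1 ∧
      (⟨((0 : ℤ) : ℚ), ((261 : ℤ) : ℚ), ((-11 : ℤ) : ℚ), ((118014 : ℤ) : ℚ), ((-12051831 : ℤ) : ℚ)⟩ : WeierstrassCurve ℚ).mordellWeilRank = 1 ∧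
      Finite (⟨((0 : ℤ) : ℚ), ((261 : ℤ) : ℚ), ((-11 : ℤ) : ℚ), ((118014 : ℤ) : ℚ), ((-12051831 : ℤ) : ℚ)⟩ : WeierstrassCurve ℚ).sha := by
  haveI := KubertTate277Descent.isElliptic
  haveI := KubertTate277EisensteinTwist.isElliptic_twist
  haveI := KubertTate277EisensteinTwist.isElliptic_model
  haveI := KubertTate277EisensteinTwist.isGloballyMinimal_model
  haveI : Fact (Nat.Prime 11) := ⟨by norm_num⟩
  obtain ⟨hω, hω₂⟩ := card_primeFactors
  have hr : ((27 : ℤ) * 7).natAbs.primeFactors.card ≤ (kubertTateFive (((27 : ℤ) : ℚ)) (((7 : ℤ) : ℚ))).mordellWeilRank + 1 := by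
    rw [hω, KubertTate277Descent.mordellWeilRank_eq]
  have hr' : (((27 : ℤ) * 7).natAbs.primeFactors.filter (fun ℓ ↦ ℓ % 3 = 1)).card ≤
      ((kubertTateFive (((27 : ℤ) : ℚ)) (((7 : ℤ) : ℚ))).quadraticTwist (-3)).mordellWeilRank := by
    rw [hω₂, KubertTate277EisensteinTwist.twist_27_7.1]
  have h := analyticRank_eq_and_finite_sha_of_eisensteinTwistModel_of_thmE 27 7 (Int.isCoprime_iff_gcd_eq_one.mpr (by norm_num))
    KubertTate277Descent.not_five_dvd_Δ KubertTate277EisensteinTwist.eisenstein_tame nonsingular_ref (by norm_num) (by norm_num) 11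
    (by norm_num) (by norm_num) KubertTate277Descent.not_tor_dvd_Δ hr hr' (by rw [hω₂]) _ _ KubertTate277EisensteinTwist.variableChange_model
    h1 h0 hGZK
  rw [hω₂] at h
  exact h

/-- **T DISCHARGED AT `W₂` MODULO REFEREED PRINT** (CGLS Thm. E + GZK): every `t_q(W₂) = 0`. [cite: CastellaGrossiLeeSkinner2022, Theorem E]
[cite: Darmon2004, Thm. 3.22] -/
theorem transfer_W₂_of_thmE
    (h1 : thmE_analyticRank_eq_one_of_selmerCorank_eq_one) (h0 : thmE_analyticRank_eq_zero_of_selmerCorank_eq_zero)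
    (hGZK : rank_eq_analyticRank_of_analyticRank_le_one) (p q : ℕ) [Fact p.Prime] [Fact q.Prime] :
    haveI := KubertTate277EisensteinTwist.isElliptic_model
    (⟨((0 : ℤ) : ℚ), ((261 : ℤ) : ℚ), ((-11 : ℤ) : ℚ), ((118014 : ℤ) : ℚ), ((-12051831 : ℤ) : ℚ)⟩ : WeierstrassCurve ℚ).shaCorank p = 0 →
      (⟨((0 : ℤ) : ℚ), ((261 : ℤ) : ℚ), ((-11 : ℤ) : ℚ), ((118014 : ℤ) : ℚ), ((-12051831 : ℤ) : ℚ)⟩ : WeierstrassCurve ℚ).shaCorank q = 0 := by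
  haveI := KubertTate277EisensteinTwist.isElliptic_model
  intro _
  haveI := (analyticRank_W₂_eq_one_and_finite_sha_of_thmE h1 h0 hGZK).2.2
  exact (finite_primaryComponent_sha_iff_shaCorank_eq_zero _ q).1 inferInstance

end Summit.BirchSwinnertonDyer.BirchSwinnertonDyer.Theorems.ShaPrimaryTransferEisensteinTwistDoor277

end
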